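import Literature.Topology.FourManifolds.TrisectionsBiCollar
import Literature.Topology.FourManifolds.RegularLevelFlowMap
import HarnessLib

/-!
# The middle region of a trisection from a handle decomposition: landing on the level `∂X₁`
# along the gradient-like flow (Gay–Kirby 2016, Lemma 14 — the sectors `X₂`, `X₃`, first layer)

Topic `Literature/Topology/FourManifolds`; infrastructure for the fact seat
`provefact-Literature.Topology.FourManifolds.exists_isBalancedGKTrisection` (Gay–Kirby 2016,
Thm. 4 via Lemma 14).  Everything in this file is **proved**; no named facts are introduced.

In Lemma 14 the middle region `{3/2 ≤ f ≤ 5/2}` of the closed `4`-manifold, which contains the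
`2`-handles, is divided between the sectors `X₂ = [0, ε] × H₁₂ ∪ (2-handles)` and `X₃` (the
rest) according to the Heegaard splitting `∂X₁ = H₁₂ ∪_F H₃₁` of the level `∂X₁ = f⁻¹(3/2)`.
Formally a point of the middle region is assigned to a side by **landing it on the level
`f = a` along the trajectories of the gradient-like field** — the projection `π(q)` "that
assigns to each point the unique intersection of its trajectory with `V₀`" of Milnor's proof of
Thm. 4.1 (the tree's `Literature.Topology.FourManifolds.levelProj`, `RegularLevelFlowMap.lean`) —
and reading the Heegaard function `g` there.  This file sets this up for a bi-collar
(`Literature.Topology.FourManifolds.BiCollar`, `TrisectionsBiCollar.lean`) whose unit-speed field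
`U.ξ` is gradient-like for the Morse function `f` (such fields exist:
`Literature.Topology.FourManifolds.IsMorse.exists_levelUnitField_isGradientLike`,
`GradientLikeUnitField.lean`):

* `BiCollar.MorseFrame B` — the hypotheses: `f` Morse and `U.ξ` gradient-like for `f`;
* `MorseFrame.Hit x` — the trajectory of `x` meets the level `f = a` (`Hits` for the flow of
  `U.ξ`); the set of such points is open (`isOpen_setOf_hit`); `MorseFrame.lam` — the landing
  map `λ = levelProj` onto the level, smooth at points which hit (`contMDiffAt_lam`), landing on
  the level (`f_lam`), constant along trajectories (`lam_fl`), **equal to the drop `U.drop` of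
  the bi-collar on its band** (`lam_eq_drop`: the band consists of points which hit, and both
  points are the point of the trajectory on the level), so that the transported Heegaard
  coordinate `G = g ∘ λ` is `b + r` on the band (`gFun_eq_of_mem_band`);
* **the dichotomy** `MorseFrame.hit_or_exists_mem_unstableSet`: a point `z` with `a ≤ f z`
  either hits the level `a`, or lies on the unstable set (Milnor's Def. 3.9; the *ascending
  sheet*) of a critical point `q` with `a ≤ f q ≤ f z` — its trajectory converges backwards to
  a critical point (`IsGradientLike.exists_isMCriticalPt_tendsto_flow_atBot`), which is either
  below the level (and then the trajectory crosses the level, intermediate value theorem) or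
  not.  In Lemma 14 (`a = 3/2`, `z` in `{f ≤ 5/2}`, critical values integers) the exceptional
  `q` are the index-`2` critical points at the level `2`: the cores of the `2`-handles, which
  Gay–Kirby put inside `X₂`.

## References

* D. Gay, R. Kirby, *Trisecting 4-manifolds*, Geom. Topol. 20 (2016) 3097–3132
  (arXiv:1205.1565): §4, Lemma 14 and its proof. [GayKirby2016]
* J. Milnor, *Lectures on the h-cobordism theorem* (1965), Def. 3.9 (PDF p. 16), Thm. 4.1 and
  its proof (PDF p. 22: the projection `π : W - K → V₀`). [MilnorHCobordism1965]
-/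

open scoped Manifold ContDiff Topology
open Set Function Filter

noncomputable section

universe u

namespace Literature.Topology.FourManifolds

open Flow

variable {X : Type u} [TopologicalSpace X] [T2Space X] [CompactSpace X]
  [ChartedSpace (EuclideanSpace ℝ (Fin 4)) X] [IsManifold (𝓡 4) ∞ X]

namespace BiCollar

variable (B : BiCollar X)

/-- **Morse frame of a bi-collar**: the function `f` is Morse and the unit-speed field `U.ξ`
across its level `a` is gradient-like for `f` (Milnor, Def. 3.1), so that the flow `U.fl` is a
gradient-like flow and Milnor's trajectory arguments apply to it.
[cite: MilnorHCobordism1965, Def. 3.1 and Thm. 4.1] -/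
structure MorseFrame where
  /-- `f` is a Morse function. -/
  isMorse : IsMorse (𝓡 4) B.f
  /-- `U.ξ` is gradient-like for `f`. -/
  isGradientLike : IsGradientLike (𝓡 4) B.f B.U.ξ

omit [T2Space X] [CompactSpace X] in
/-- No critical point lies on the level `f = a`. [folklore] -/
theorem not_isMCriticalPt_of_apply_eq_a {x : X} (hx : B.f x = B.a) : ¬ IsMCriticalPt (𝓡 4) B.f x :=
  B.hf.not_isMCriticalPt hx

/-- **`x` hits the level**: the trajectory of `x` under the flow of `U.ξ` meets `{f = a}`.
[cite: MilnorHCobordism1965, Thm. 4.1 (PDF p. 22)] -/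
def Hit (x : X) : Prop := Hits (flowθ B.U.contMDiff) B.f B.a x

/-- `Hit x` iff `f (U.fl x t) = a` for some `t`. [folklore] -/
theorem hit_iff {x : X} : B.Hit x ↔ ∃ t : ℝ, B.f (B.U.fl x t) = B.a := Iff.rfl

/-- Points of the band of `U` hit the level (the clock: flow for time `a - f x`).
[cite: MilnorHCobordism1965, proof of Thm. 3.4] -/
theorem hit_of_mem_band {x : X} (hx : x ∈ B.U.band) : B.Hit x :=
  ⟨B.a - B.f x, B.U.apply_drop hx⟩

/-- `Hit` is a property of trajectories. [folklore] -/
theorem hit_fl {x : X} (hx : B.Hit x) (t : ℝ) : B.Hit (B.U.fl x t) := by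
  obtain ⟨s, hs⟩ := hx
  refine ⟨s - t, ?_⟩
  show B.f (B.U.fl (B.U.fl x t) (s - t)) = B.a
  rw [← B.U.fl_add, add_sub_cancel]
  exact hs

/-- **The landing map** `λ`: the projection along trajectories onto the level `f = a`
(Milnor's `π`; meaningful at points which hit). [cite: MilnorHCobordism1965, Thm. 4.1 (PDF p. 22)] -/
def lam (x : X) : X := levelProj B.U.contMDiff B.f B.a x

/-- The landing map lands on the level. [cite: MilnorHCobordism1965, Thm. 4.1 (PDF p. 22)] -/
theorem f_lam {x : X} (hx : B.Hit x) : B.f (B.lam x) = B.a := apply_levelProj B.U.contMDiff hx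

open Classical in
/-- The landing map lifted to the level manifold `Y` (junk `yL x` where the trajectory does
not land on the level). [cite: MilnorHCobordism1965, Thm. 4.1 (PDF p. 22)] -/
def lamLift (x : X) : B.Y := if h : B.f (B.lam x) = B.a then ⟨B.lam x, h⟩ else B.yL x

/-- At points which hit, `lamLift` is `λ`. [folklore] -/
theorem incl_lamLift {x : X} (hx : B.Hit x) : RegularLevel.incl B.hf (B.lamLift x) = B.lam x := by
  have h : B.f (B.lam x) = B.a := B.f_lam hx
  simp only [lamLift, h, ↓reduceDIte]

/-- **The transported Heegaard coordinate** `G = g ∘ λ - b`: the value of `g - b` at the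
landing point (meaningful at points which hit). [cite: GayKirby2016, §4, Lemma 14] -/
def gFun (x : X) : ℝ := B.g (B.lamLift x) - B.b

namespace MorseFrame

variable {B} (Fr : B.MorseFrame)

include Fr

/-- **The set of points hitting the level is open.** [cite: MilnorHCobordism1965, proof of Thm. 5.4, Assertion 4 (PDF p. 29)] -/
theorem isOpen_setOf_hit : IsOpen {x : X | B.Hit x} :=
  IsGradientLike.isOpen_setOf_hits Fr.isGradientLike Fr.isMorse B.U.contMDiff
    fun _ hx => B.not_isMCriticalPt_of_apply_eq_a hx

/-- The landing map is the identity on the level. [cite: MilnorHCobordism1965, Thm. 4.1 (PDF p. 22)] -/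
theorem lam_of_apply_eq {x : X} (hx : B.f x = B.a) : B.lam x = x :=
  IsGradientLike.levelProj_of_apply_eq Fr.isGradientLike Fr.isMorse B.U.contMDiff
    (fun _ hy => B.not_isMCriticalPt_of_apply_eq_a hy) hx

/-- The landing map is constant along trajectories. [cite: MilnorHCobordism1965, Thm. 4.1 (PDF p. 22)] -/
theorem lam_fl {x : X} (hx : B.Hit x) (t : ℝ) : B.lam (B.U.fl x t) = B.lam x :=
  IsGradientLike.levelProj_flow Fr.isGradientLike Fr.isMorse B.U.contMDiff
    (fun _ hy => B.not_isMCriticalPt_of_apply_eq_a hy) hx t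

/-- **The landing map is smooth at points which hit the level** (Milnor, Assertion 4).
[cite: MilnorHCobordism1965, proof of Thm. 5.4, Assertion 4 (PDF p. 29)] -/
theorem contMDiffAt_lam {x : X} (hx : B.Hit x) : ContMDiffAt (𝓡 4) (𝓡 4) ∞ B.lam x :=
  IsGradientLike.contMDiffAt_levelProj Fr.isGradientLike Fr.isMorse B.U.contMDiff
    (fun _ hy => B.not_isMCriticalPt_of_apply_eq_a hy) hx

/-- The landing map is continuous on the open set of points which hit. [cite: MilnorHCobordism1965, Thm. 4.1 (PDF p. 22)] -/
theorem continuousOn_lam : ContinuousOn B.lam {x : X | B.Hit x} := fun _ hx =>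
  (Fr.contMDiffAt_lam hx).continuousAt.continuousWithinAt

/-- **On the band of `U` the landing map is the drop of the bi-collar**: `λ x = U.drop x`
(the drop is the point `U.fl x (a - f x)` of the trajectory, on the level).
[cite: MilnorHCobordism1965, proof of Thm. 3.4 and Thm. 4.1] -/
theorem lam_eq_drop {x : X} (hx : x ∈ B.U.band) : B.lam x = B.U.drop x := by
  have h1 : B.lam (B.U.drop x) = B.lam x := Fr.lam_fl (B.hit_of_mem_band hx) (B.a - B.f x)
  rw [← h1]
  exact Fr.lam_of_apply_eq (B.U.apply_drop hx)

/-- On the band, `λ x = yL x` as points of `X`. [cite: MilnorHCobordism1965, proof of Thm. 3.4] -/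
theorem lam_eq_incl_yL {x : X} (hx : x ∈ B.U.band) : B.lam x = RegularLevel.incl B.hf (B.yL x) := by
  rw [Fr.lam_eq_drop hx, B.incl_yL hx]

/-- On the band, `lamLift = yL`. [folklore] -/
theorem lamLift_eq_yL {x : X} (hx : x ∈ B.U.band) : B.lamLift x = B.yL x := by
  apply (RegularLevel.isEmbedding_incl B.hf).injective
  rw [B.incl_lamLift (B.hit_of_mem_band hx), Fr.lam_eq_incl_yL hx]

/-- **On the band `G = r`**, the bi-collar coordinate (`λ` is the drop there).
[cite: GayKirby2016, §4, Lemma 14] -/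
theorem gFun_eq_rFun {x : X} (hx : x ∈ B.U.band) : B.gFun x = B.rFun x := by
  rw [gFun, Fr.lamLift_eq_yL hx]; rfl

/-- `G` is constant along trajectories (at points which hit). [cite: GayKirby2016, §4, Lemma 14] -/
theorem gFun_fl {x : X} (hx : B.Hit x) (t : ℝ) : B.gFun (B.U.fl x t) = B.gFun x := by
  have h1 : B.lamLift (B.U.fl x t) = B.lamLift x := by
    apply (RegularLevel.isEmbedding_incl B.hf).injective
    rw [B.incl_lamLift (B.hit_fl hx t), B.incl_lamLift hx, Fr.lam_fl hx t]
  rw [gFun, gFun, h1]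

/-! ### The dichotomy: hitting the level, or lying on an ascending sheet -/

/-- Along a trajectory `f` is nondecreasing (`U.ξ(f) ≥ 0`). [cite: MilnorHCobordism1965, Def. 3.1] -/
theorem monotone_f_fl (x : X) : Monotone fun t => B.f (B.U.fl x t) := by
  have hf : MDifferentiable (𝓡 4) 𝓘(ℝ, ℝ) B.f := (IsMorse.contMDiff Fr.isMorse).mdifferentiable (by simp)
  have h0 : ∀ y, 0 ≤ mlineDeriv (𝓡 4) B.f y (B.U.ξ y) := fun y => by
    by_cases hy : IsMCriticalPt (𝓡 4) B.f y
    · have h : mfderiv (𝓡 4) 𝓘(ℝ, ℝ) B.f y = 0 := hy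
      rw [mlineDeriv_def, h]; exact le_rfl
    · exact (IsGradientLike.mlineDeriv_pos Fr.isGradientLike y hy).le
  exact monotone_comp_flow B.U.contMDiff hf h0 x

/-- **The dichotomy.**  A point `z` with `a ≤ f z` either hits the level `f = a`, or lies on the
unstable set (ascending sheet, Milnor's Def. 3.9) of a critical point `q` with
`a ≤ f q ≤ f z`: the trajectory of `z` converges backwards to a critical point `q`; if
`f q < a` the trajectory crosses the level (intermediate value theorem), otherwise
`z ∈ unstableSet q`. [cite: MilnorHCobordism1965, Def. 3.9 (PDF p. 16) and Thm. 4.1 (PDF p. 22)] -/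
theorem hit_or_exists_mem_unstableSet {z : X} (hz : B.a ≤ B.f z) :
    B.Hit z ∨ ∃ q : X, IsMCriticalPt (𝓡 4) B.f q ∧ B.a ≤ B.f q ∧ B.f q ≤ B.f z ∧
      z ∈ unstableSet (𝓡 4) B.U.ξ q := by
  obtain ⟨q, hq, hlim⟩ :=
    IsGradientLike.exists_isMCriticalPt_tendsto_flow_atBot Fr.isGradientLike Fr.isMorse B.U.contMDiff z
  have hflim : Tendsto (fun t => B.f (B.U.fl z t)) atBot (𝓝 (B.f q)) :=
    (B.U.contMDiff_f.continuous.tendsto q).comp hlim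
  have hmono := Fr.monotone_f_fl z
  -- `f q ≤ f (U.fl z t)` for every `t`, in particular `f q ≤ f z`
  have hle : ∀ t, B.f q ≤ B.f (B.U.fl z t) := fun t =>
    le_of_tendsto hflim (Filter.eventually_atBot.2 ⟨t, fun s hs => hmono hs⟩)
  by_cases hqa : B.f q < B.a
  · -- the trajectory crosses the level `a`
    left
    obtain ⟨t₀, ht₀⟩ : ∃ t₀, B.f (B.U.fl z t₀) < B.a := by
      have hev : ∀ᶠ t in atBot, B.f (B.U.fl z t) < B.a :=
        hflim.eventually (Iio_mem_nhds hqa)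
      exact hev.exists
    have hcont : Continuous fun t => B.f (B.U.fl z t) :=
      B.U.contMDiff_f.continuous.comp (B.U.continuous_fl.comp (continuous_const.prodMk continuous_id))
    have h0 : B.a ≤ B.f (B.U.fl z 0) := by rw [B.U.fl_zero]; exact hz
    have ht₀0 : t₀ ≤ 0 := by
      by_contra h
      have := hmono (le_of_lt (not_le.1 h))
      simp only at this
      linarith [this, h0, ht₀]
    obtain ⟨t, -, ht⟩ := intermediate_value_Icc ht₀0 hcont.continuousOn ⟨ht₀.le, h0⟩
    exact ⟨t, ht⟩
  · right
    refine ⟨q, hq, not_lt.1 hqa, ?_, ?_⟩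
    · have := hle 0
      rwa [B.U.fl_zero] at this
    · rw [unstableSet_eq_setOf_tendsto B.U.contMDiff]
      exact hlim

end MorseFrame

end BiCollar

end Literature.Topology.FourManifolds

end
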